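import Mathlib
import HarnessLib
import Summits.QuantumFields.YangMills.Theses.GronwallGap
import Summits.QuantumFields.YangMills.Theorems.GronwallGapPathGapModulusContinuity

/-!
# `PathGapModulus` (stmt-QuantumFields-13946) — the trichotomy reshape of line `registered` (lead c2, cycle 3)

Helpers for the crux `Summit.QuantumFields.YangMills.Theses.GronwallGap.PathGapModulus` (route `GronwallGap`).
Cycle 2 (lead c1) cut the crux — tree-certified equivalent to NoGapCollapse (`pathGapModulus_iff_noGapCollapse`) —
into `localFloor` (the uniformly-clustering parameter set `Γ_w = {s ∈ [0,1] : ∃ m > 0, UCw w s m}` is relatively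
open WITH a locally uniform rate) and `closed` (`Γ_w` is relatively closed), composition
`pathGapModulus_of_localFloor_of_closed`. This file refines that cut into the three mutually independent mechanisms by
which a mass gap can be lost along a one-parameter family, so that each registered stub of the reshaped skeleton
names ONE recognisable conjecture:

* (S1, `open`) `Γ_w` is relatively open in `[0,1]` — perturbative stability of volume-uniform clustering, no rate
  bookkeeping;
* (S2, `uniformRate`) one rate serves every clustering parameter: `∃ μ > 0, ∀ s ∈ Γ_w, UCw w s μ` — "no critical
  slowing down along an analytic-pressure path" (a correlation length diverging along `Γ_w` must leave a trace in the
  pressure);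
* (S3, `closedAtRate`) a parameter approximated by parameters clustering at one COMMON rate clusters — "no phase
  coexistence invisible to single-plaquette class-function directions" (the only way clustering constants can blow up
  at a fixed rate).

Proved here (pure logic on `[0,1]`, no measure theory is touched):
`pathGap_localFloor_of_open_of_uniformRate` (S1 + S2 ⇒ localFloor), `pathGap_closed_of_uniformRate_of_closedAtRate`
(S2 + S3 ⇒ closed), the composition `pathGapModulus_of_open_of_uniformRate_of_closedAtRate` (S1 → S2 → S3 → crux, whose
three hypotheses are the statements of the registered stubs `stub_clusteringOpen`, `stub_uniformRate`,
`stub_closedAtCommonRate` verbatim), and the three converses `pathGap_open_of_pathGapModulus`,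
`pathGap_uniformRate_of_pathGapModulus`, `pathGap_closedAtRate_of_pathGapModulus` (the crux implies each stub: the
reshape loses nothing and a refutation of any stub refutes the crux), packaged as the equivalence
`pathGapModulus_iff_trichotomy : PathGapModulus ↔ (S1 ∧ S2 ∧ S3)` (the registered sub-goal through which this file lands).
-/

namespace Summit.QuantumFields.YangMills.Theorems

open Set

/-- **S1 + S2 ⇒ local floor (abstract).** For any predicate `P s m` ("rate `m` is available at parameter `s`"):
if the set of parameters of `[0,1]` carrying a rate is relatively open (S1) and one rate `μ` serves every parameter
carrying a rate (S2), then every parameter carrying a rate has a neighbourhood in `[0,1]` on which the common rate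
`μ` is available — the hypothesis shape of `pathGap_uniformFloor_of_localFloor_of_closed`. [folklore] -/
theorem pathGap_localFloor_of_open_of_uniformRate {P : ℝ → ℝ → Prop}
    (h₁ : ∀ s₀ ∈ Set.Icc (0 : ℝ) 1, (∃ m₀ : ℝ, 0 < m₀ ∧ P s₀ m₀) →
      ∃ ε : ℝ, 0 < ε ∧ ∀ s ∈ Set.Icc (0 : ℝ) 1, |s - s₀| < ε → ∃ m : ℝ, 0 < m ∧ P s m)
    (h₂ : ∃ μ : ℝ, 0 < μ ∧ ∀ s ∈ Set.Icc (0 : ℝ) 1, (∃ m : ℝ, 0 < m ∧ P s m) → P s μ) :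
    ∀ s₀ ∈ Set.Icc (0 : ℝ) 1, ∀ m₀ : ℝ, 0 < m₀ → P s₀ m₀ →
      ∃ ε μ : ℝ, 0 < ε ∧ 0 < μ ∧ ∀ s ∈ Set.Icc (0 : ℝ) 1, |s - s₀| < ε → P s μ := by
  intro s₀ hs₀ m₀ hm₀ hP
  obtain ⟨ε, hε, hopen⟩ := h₁ s₀ hs₀ ⟨m₀, hm₀, hP⟩
  obtain ⟨μ, hμ, hrate⟩ := h₂
  exact ⟨ε, μ, hε, hμ, fun s hs hd => hrate s hs (hopen s hs hd)⟩

/-- **S2 + S3 ⇒ closedness (abstract).** If one rate `μ` serves every parameter carrying a rate (S2) and a parameter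
approximated by parameters carrying the common rate `μ` carries a rate (S3), then a parameter approximated by
parameters carrying ANY rates carries a rate — the closedness hypothesis of
`pathGap_uniformFloor_of_localFloor_of_closed`. [folklore] -/
theorem pathGap_closed_of_uniformRate_of_closedAtRate {P : ℝ → ℝ → Prop}
    (h₂ : ∃ μ : ℝ, 0 < μ ∧ ∀ s ∈ Set.Icc (0 : ℝ) 1, (∃ m : ℝ, 0 < m ∧ P s m) → P s μ)
    (h₃ : ∀ s₀ ∈ Set.Icc (0 : ℝ) 1, ∀ μ : ℝ, 0 < μ →
      (∀ ε : ℝ, 0 < ε → ∃ s ∈ Set.Icc (0 : ℝ) 1, |s - s₀| < ε ∧ P s μ) → ∃ m₀ : ℝ, 0 < m₀ ∧ P s₀ m₀) :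
    ∀ s₀ ∈ Set.Icc (0 : ℝ) 1, (∀ ε : ℝ, 0 < ε → ∃ s ∈ Set.Icc (0 : ℝ) 1, |s - s₀| < ε ∧ ∃ m : ℝ, 0 < m ∧ P s m) →
      ∃ m₀ : ℝ, 0 < m₀ ∧ P s₀ m₀ := by
  intro s₀ hs₀ happrox
  obtain ⟨μ, hμ, hrate⟩ := h₂
  refine h₃ s₀ hs₀ μ hμ fun ε hε => ?_
  obtain ⟨s, hs, hd, hm⟩ := happrox ε hε
  exact ⟨s, hs, hd, hrate s hs hm⟩

/-- **The crux from the three registered stubs of the reshaped skeleton** (line `registered`, skeleton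
`Cruxes/PathGapModulus/Lines/birth.lean`, lead c2, cycle 3): the statements of `stub_clusteringOpen` (S1),
`stub_uniformRate` (S2) and `stub_closedAtCommonRate` (S3), verbatim and in this order, imply `PathGapModulus` — through
lead c1's composition `pathGapModulus_of_localFloor_of_closed` and the two abstract lemmas above with `P := UCw w`.
[folklore] -/
theorem pathGapModulus_of_open_of_uniformRate_of_closedAtRate :
    (∀ (G : Type) [Group G] [TopologicalSpace G] [IsTopologicalGroup G] [CompactSpace G],
      Literature.MathematicalPhysics.QuantumFieldTheory.IsCompactSimpleLieGroup G →
      letI : MeasurableSpace G := borel G; haveI : BorelSpace G := ⟨rfl⟩;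
      let UCw : (ℝ → G → ℝ) → ℝ → ℝ → Prop := fun w s m => ∀ A B : Literature.MathematicalPhysics.QuantumFieldTheory.YMSpecies G, ∃ C : ℝ, ∃ S₀ : ℕ, ∀ S : ℕ, S₀ ≤ S → ∀ n : ℕ, n ≤ S → |(∫ U, A.F (Literature.MathematicalPhysics.QuantumLattice.torusLift (2 * S + 1) U) * B.F (Literature.MathematicalPhysics.QuantumLattice.configShift (-Pi.single 0 (n : ℤ)) (Literature.MathematicalPhysics.QuantumLattice.torusLift (2 * S + 1) U)) ∂(Literature.MathematicalPhysics.QuantumLattice.groupHeatKernelMeasure (d := 4) (L := 2 * S + 1) w s)) - (∫ U, A.F (Literature.MathematicalPhysics.QuantumLattice.torusLift (2 * S + 1) U) ∂(Literature.MathematicalPhysics.QuantumLattice.groupHeatKernelMeasure (d := 4) (L := 2 * S + 1) w s)) * (∫ U, B.F (Literature.MathematicalPhysics.QuantumLattice.torusLift (2 * S + 1) U) ∂(Literature.MathematicalPhysics.QuantumLattice.groupHeatKernelMeasure (d := 4) (L := 2 * S + 1) w s))| ≤ C * Real.exp (-(m * n));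
      let Pseq : (G → ℝ) → ℕ → ℝ := fun v L => (((L + 1 : ℕ) : ℝ) ^ 4)⁻¹ * Real.log (((MeasureTheory.Measure.pi fun _ : Literature.MathematicalPhysics.QuantumFieldTheory.Edge 4 (L + 1) => Literature.MathematicalPhysics.QuantumFieldTheory.haarProbability G).withDensity (fun U : Literature.MathematicalPhysics.QuantumFieldTheory.GaugeConfig 4 (L + 1) G => ENNReal.ofReal (Literature.MathematicalPhysics.QuantumLattice.groupHeatKernelWeight (fun _ : ℝ => v) 0 U))) Set.univ).toReal;
      let AnP : (G → ℝ) → Prop := fun v => ∀ φ : G → ℝ, Continuous φ → (∀ g h : G, φ (h * g * h⁻¹) = φ g) → ∃ p : ℝ → ℝ, (∀ t : ℝ, Filter.Tendsto (fun L : ℕ => Pseq (fun g => v g * Real.exp (t * φ g)) L) Filter.atTop (nhds (p t))) ∧ AnalyticAt ℝ p 0;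
      let Adm : (ℝ → G → ℝ) → Prop := fun w => (∀ s ∈ Set.Icc (0 : ℝ) 1, Continuous (w s) ∧ (∀ g : G, 0 < w s g) ∧ (∀ g h : G, w s (h * g * h⁻¹) = w s g) ∧ (∀ g : G, w s g⁻¹ = w s g) ∧ (∀ (n : ℕ) (x : Fin n → G) (c : Fin n → ℂ), 0 ≤ (∑ i, ∑ j, (starRingEnd ℂ) (c i) * c j * ((w s ((x i)⁻¹ * x j) : ℝ) : ℂ)).re)) ∧ ∃ Λ : ℝ, ∀ s ∈ Set.Icc (0 : ℝ) 1, ∀ s' ∈ Set.Icc (0 : ℝ) 1, ∀ g : G, |Real.log (w s g) - Real.log (w s' g)| ≤ Λ * |s - s'|;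
      ∀ w : ℝ → G → ℝ, Adm w → (∀ s ∈ Set.Icc (0 : ℝ) 1, AnP (w s)) →
        ∀ s₀ ∈ Set.Icc (0 : ℝ) 1, (∃ m₀ : ℝ, 0 < m₀ ∧ UCw w s₀ m₀) → ∃ ε : ℝ, 0 < ε ∧ ∀ s ∈ Set.Icc (0 : ℝ) 1, |s - s₀| < ε → ∃ m : ℝ, 0 < m ∧ UCw w s m) →
    (∀ (G : Type) [Group G] [TopologicalSpace G] [IsTopologicalGroup G] [CompactSpace G],
      Literature.MathematicalPhysics.QuantumFieldTheory.IsCompactSimpleLieGroup G →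
      letI : MeasurableSpace G := borel G; haveI : BorelSpace G := ⟨rfl⟩;
      let UCw : (ℝ → G → ℝ) → ℝ → ℝ → Prop := fun w s m => ∀ A B : Literature.MathematicalPhysics.QuantumFieldTheory.YMSpecies G, ∃ C : ℝ, ∃ S₀ : ℕ, ∀ S : ℕ, S₀ ≤ S → ∀ n : ℕ, n ≤ S → |(∫ U, A.F (Literature.MathematicalPhysics.QuantumLattice.torusLift (2 * S + 1) U) * B.F (Literature.MathematicalPhysics.QuantumLattice.configShift (-Pi.single 0 (n : ℤ)) (Literature.MathematicalPhysics.QuantumLattice.torusLift (2 * S + 1) U)) ∂(Literature.MathematicalPhysics.QuantumLattice.groupHeatKernelMeasure (d := 4) (L := 2 * S + 1) w s)) - (∫ U, A.F (Literature.MathematicalPhysics.QuantumLattice.torusLift (2 * S + 1) U) ∂(Literature.MathematicalPhysics.QuantumLattice.groupHeatKernelMeasure (d := 4) (L := 2 * S + 1) w s)) * (∫ U, B.F (Literature.MathematicalPhysics.QuantumLattice.torusLift (2 * S + 1) U) ∂(Literature.MathematicalPhysics.QuantumLattice.groupHeatKernelMeasure (d := 4) (L := 2 * S + 1) w s))| ≤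 C * Real.exp (-(m * n));
      let Pseq : (G → ℝ) → ℕ → ℝ := fun v L => (((L + 1 : ℕ) : ℝ) ^ 4)⁻¹ * Real.log (((MeasureTheory.Measure.pi fun _ : Literature.MathematicalPhysics.QuantumFieldTheory.Edge 4 (L + 1) => Literature.MathematicalPhysics.QuantumFieldTheory.haarProbability G).withDensity (fun U : Literature.MathematicalPhysics.QuantumFieldTheory.GaugeConfig 4 (L + 1) G => ENNReal.ofReal (Literature.MathematicalPhysics.QuantumLattice.groupHeatKernelWeight (fun _ : ℝ => v) 0 U))) Set.univ).toReal;
      let AnP : (G → ℝ) → Prop := fun v => ∀ φ : G → ℝ, Continuous φ → (∀ g h : G, φ (h * g * h⁻¹) = φ g) → ∃ p : ℝ → ℝ, (∀ t : ℝ, Filter.Tendsto (fun L : ℕ => Pseq (fun g => v g * Real.exp (t * φ g)) L) Filter.atTop (nhds (p t))) ∧ AnalyticAt ℝ p 0;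
      let Adm : (ℝ → G → ℝ) → Prop := fun w => (∀ s ∈ Set.Icc (0 : ℝ) 1, Continuous (w s) ∧ (∀ g : G, 0 < w s g) ∧ (∀ g h : G, w s (h * g * h⁻¹) = w s g) ∧ (∀ g : G, w s g⁻¹ = w s g) ∧ (∀ (n : ℕ) (x : Fin n → G) (c : Fin n → ℂ), 0 ≤ (∑ i, ∑ j, (starRingEnd ℂ) (c i) * c j * ((w s ((x i)⁻¹ * x j) : ℝ) : ℂ)).re)) ∧ ∃ Λ : ℝ, ∀ s ∈ Set.Icc (0 : ℝ) 1, ∀ s' ∈ Set.Icc (0 : ℝ) 1, ∀ g : G, |Real.log (w s g) - Real.log (w s' g)| ≤ Λ * |s - s'|;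
      ∀ w : ℝ → G → ℝ, Adm w → (∀ s ∈ Set.Icc (0 : ℝ) 1, AnP (w s)) →
        ∃ μ : ℝ, 0 < μ ∧ ∀ s ∈ Set.Icc (0 : ℝ) 1, (∃ m : ℝ, 0 < m ∧ UCw w s m) → UCw w s μ) →
    (∀ (G : Type) [Group G] [TopologicalSpace G] [IsTopologicalGroup G] [CompactSpace G],
      Literature.MathematicalPhysics.QuantumFieldTheory.IsCompactSimpleLieGroup G →
      letI : MeasurableSpace G := borel G; haveI : BorelSpace G := ⟨rfl⟩;
      let UCw : (ℝ → G → ℝ) → ℝ → ℝ → Prop := fun w s m => ∀ A B : Literature.MathematicalPhysics.QuantumFieldTheory.YMSpecies G, ∃ C : ℝ, ∃ S₀ : ℕ, ∀ S : ℕ, S₀ ≤ S → ∀ n : ℕ, n ≤ S → |(∫ U, A.F (Literature.MathematicalPhysics.QuantumLattice.torusLift (2 * S + 1) U) * B.F (Literature.MathematicalPhysics.QuantumLattice.configShift (-Pi.single 0 (n : ℤ)) (Literature.MathematicalPhysics.QuantumLattice.torusLift (2 * S + 1) U)) ∂(Literature.MathematicalPhysics.QuantumLattice.groupHeatKernelMeasure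 (d := 4) (L := 2 * S + 1) w s)) - (∫ U, A.F (Literature.MathematicalPhysics.QuantumLattice.torusLift (2 * S + 1) U) ∂(Literature.MathematicalPhysics.QuantumLattice.groupHeatKernelMeasure (d := 4) (L := 2 * S + 1) w s)) * (∫ U, B.F (Literature.MathematicalPhysics.QuantumLattice.torusLift (2 * S + 1) U) ∂(Literature.MathematicalPhysics.QuantumLattice.groupHeatKernelMeasure (d := 4) (L := 2 * S + 1) w s))| ≤ C * Real.exp (-(m * n));
      let Pseq : (G → ℝ) → ℕ → ℝ := fun v L => (((L + 1 : ℕ) : ℝ) ^ 4)⁻¹ * Real.log (((MeasureTheory.Measure.pi fun _ : Literature.MathematicalPhysics.QuantumFieldTheory.Edge 4 (L + 1) => Literature.MathematicalPhysics.QuantumFieldTheory.haarProbability G).withDensity (fun U : Literature.MathematicalPhysics.QuantumFieldTheory.GaugeConfig 4 (L + 1) G => ENNReal.ofReal (Literature.MathematicalPhysics.QuantumLattice.groupHeatKernelWeight (fun _ : ℝ => v) 0 U))) Set.univ).toReal;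
      let AnP : (G → ℝ) → Prop := fun v => ∀ φ : G → ℝ, Continuous φ → (∀ g h : G, φ (h * g * h⁻¹) = φ g) → ∃ p : ℝ → ℝ, (∀ t : ℝ, Filter.Tendsto (fun L : ℕ => Pseq (fun g => v g * Real.exp (t * φ g)) L) Filter.atTop (nhds (p t))) ∧ AnalyticAt ℝ p 0;
      let Adm : (ℝ → G → ℝ) → Prop := fun w => (∀ s ∈ Set.Icc (0 : ℝ) 1, Continuous (w s) ∧ (∀ g : G, 0 < w s g) ∧ (∀ g h : G, w s (h * g * h⁻¹) = w s g) ∧ (∀ g : G, w s g⁻¹ = w s g) ∧ (∀ (n : ℕ) (x : Fin n → G) (c : Fin n → ℂ), 0 ≤ (∑ i, ∑ j, (starRingEnd ℂ) (c i) * c j * ((w s ((x i)⁻¹ * x j) : ℝ) : ℂ)).re)) ∧ ∃ Λ : ℝ, ∀ s ∈ Set.Icc (0 : ℝ) 1, ∀ s' ∈ Set.Icc (0 : ℝ) 1, ∀ g : G, |Real.log (w s g) - Real.log (w s' g)| ≤ Λ * |s - s'|;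
      ∀ w : ℝ → G → ℝ, Adm w → (∀ s ∈ Set.Icc (0 : ℝ) 1, AnP (w s)) →
        ∀ s₀ ∈ Set.Icc (0 : ℝ) 1, ∀ μ : ℝ, 0 < μ → (∀ ε : ℝ, 0 < ε → ∃ s ∈ Set.Icc (0 : ℝ) 1, |s - s₀| < ε ∧ UCw w s μ) → ∃ m₀ : ℝ, 0 < m₀ ∧ UCw w s₀ m₀) →
    Summit.QuantumFields.YangMills.Theses.GronwallGap.PathGapModulus := by
  intro h₁ h₂ h₃
  refine pathGapModulus_of_localFloor_of_closed ?_ ?_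
  · intro G _ _ _ _ hG UCw Pseq AnP Adm w hAdm hAn
    exact pathGap_localFloor_of_open_of_uniformRate (h₁ G hG w hAdm hAn) (h₂ G hG w hAdm hAn)
  · intro G _ _ _ _ hG UCw Pseq AnP Adm w hAdm hAn
    exact pathGap_closed_of_uniformRate_of_closedAtRate (h₂ G hG w hAdm hAn) (h₃ G hG w hAdm hAn)

/-- **The reshape loses nothing, part 1**: the crux implies S1 (`stub_clusteringOpen`) — through NoGapCollapse one
clustering parameter forces a common rate everywhere, so every `ε > 0` works. [folklore] -/
theorem pathGap_open_of_pathGapModulus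
    (h : Summit.QuantumFields.YangMills.Theses.GronwallGap.PathGapModulus) :
    ∀ (G : Type) [Group G] [TopologicalSpace G] [IsTopologicalGroup G] [CompactSpace G],
      Literature.MathematicalPhysics.QuantumFieldTheory.IsCompactSimpleLieGroup G →
      letI : MeasurableSpace G := borel G; haveI : BorelSpace G := ⟨rfl⟩;
      let UCw : (ℝ → G → ℝ) → ℝ → ℝ → Prop := fun w s m => ∀ A B : Literature.MathematicalPhysics.QuantumFieldTheory.YMSpecies G, ∃ C : ℝ, ∃ S₀ : ℕ, ∀ S : ℕ, S₀ ≤ S → ∀ n : ℕ, n ≤ S → |(∫ U, A.F (Literature.MathematicalPhysics.QuantumLattice.torusLift (2 * S + 1) U) * B.F (Literature.MathematicalPhysics.QuantumLattice.configShift (-Pi.single 0 (n : ℤ)) (Literature.MathematicalPhysics.QuantumLattice.torusLift (2 * S + 1) U)) ∂(Literature.MathematicalPhysics.QuantumLattice.groupHeatKernelMeasure (d := 4) (L := 2 * S + 1) w s)) - (∫ U, A.F (Literature.MathematicalPhysics.QuantumLattice.torusLift (2 * S + 1) U) ∂(Literature.MathematicalPhysics.QuantumLattice.groupHeatKernelMeasure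 (d := 4) (L := 2 * S + 1) w s)) * (∫ U, B.F (Literature.MathematicalPhysics.QuantumLattice.torusLift (2 * S + 1) U) ∂(Literature.MathematicalPhysics.QuantumLattice.groupHeatKernelMeasure (d := 4) (L := 2 * S + 1) w s))| ≤ C * Real.exp (-(m * n));
      let Pseq : (G → ℝ) → ℕ → ℝ := fun v L => (((L + 1 : ℕ) : ℝ) ^ 4)⁻¹ * Real.log (((MeasureTheory.Measure.pi fun _ : Literature.MathematicalPhysics.QuantumFieldTheory.Edge 4 (L + 1) => Literature.MathematicalPhysics.QuantumFieldTheory.haarProbability G).withDensity (fun U : Literature.MathematicalPhysics.QuantumFieldTheory.GaugeConfig 4 (L + 1) G => ENNReal.ofReal (Literature.MathematicalPhysics.QuantumLattice.groupHeatKernelWeight (fun _ : ℝ => v) 0 U))) Set.univ).toReal;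
      let AnP : (G → ℝ) → Prop := fun v => ∀ φ : G → ℝ, Continuous φ → (∀ g h : G, φ (h * g * h⁻¹) = φ g) → ∃ p : ℝ → ℝ, (∀ t : ℝ, Filter.Tendsto (fun L : ℕ => Pseq (fun g => v g * Real.exp (t * φ g)) L) Filter.atTop (nhds (p t))) ∧ AnalyticAt ℝ p 0;
      let Adm : (ℝ → G → ℝ) → Prop := fun w => (∀ s ∈ Set.Icc (0 : ℝ) 1, Continuous (w s) ∧ (∀ g : G, 0 < w s g) ∧ (∀ g h : G, w s (h * g * h⁻¹) = w s g) ∧ (∀ g : G, w s g⁻¹ = w s g) ∧ (∀ (n : ℕ) (x : Fin n → G) (c : Fin n → ℂ), 0 ≤ (∑ i, ∑ j, (starRingEnd ℂ) (c i) * c j * ((w s ((x i)⁻¹ * x j) : ℝ) : ℂ)).re)) ∧ ∃ Λ : ℝ, ∀ s ∈ Set.Icc (0 : ℝ) 1, ∀ s' ∈ Set.Icc (0 : ℝ) 1, ∀ g : G, |Real.log (w s g) - Real.log (w s' g)| ≤ Λ * |s - s'|;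
      ∀ w : ℝ → G → ℝ, Adm w → (∀ s ∈ Set.Icc (0 : ℝ) 1, AnP (w s)) →
        ∀ s₀ ∈ Set.Icc (0 : ℝ) 1, (∃ m₀ : ℝ, 0 < m₀ ∧ UCw w s₀ m₀) → ∃ ε : ℝ, 0 < ε ∧ ∀ s ∈ Set.Icc (0 : ℝ) 1, |s - s₀| < ε → ∃ m : ℝ, 0 < m ∧ UCw w s m := by
  intro G _ _ _ _ hG UCw Pseq AnP Adm w hAdm hAn s₀ hs₀ hex
  obtain ⟨m₀, hm₀, hU₀⟩ := hex
  obtain ⟨μ, hμ, hall⟩ := pathGapModulus_iff_noGapCollapse.mp h G hG w hAdm hAn ⟨s₀, hs₀, m₀, hm₀, hU₀⟩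
  exact ⟨1, one_pos, fun s hs _ => ⟨μ, hμ, hall s hs⟩⟩

/-- **The reshape loses nothing, part 2**: the crux implies S2 (`stub_uniformRate`) — if no parameter clusters the
inner implication is vacuous (`μ := 1`), otherwise NoGapCollapse supplies the common rate. [folklore] -/
theorem pathGap_uniformRate_of_pathGapModulus
    (h : Summit.QuantumFields.YangMills.Theses.GronwallGap.PathGapModulus) :
    ∀ (G : Type) [Group G] [TopologicalSpace G] [IsTopologicalGroup G] [CompactSpace G],
      Literature.MathematicalPhysics.QuantumFieldTheory.IsCompactSimpleLieGroup G →
      letI : MeasurableSpace G := borel G; haveI : BorelSpace G := ⟨rfl⟩;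
      let UCw : (ℝ → G → ℝ) → ℝ → ℝ → Prop := fun w s m => ∀ A B : Literature.MathematicalPhysics.QuantumFieldTheory.YMSpecies G, ∃ C : ℝ, ∃ S₀ : ℕ, ∀ S : ℕ, S₀ ≤ S → ∀ n : ℕ, n ≤ S → |(∫ U, A.F (Literature.MathematicalPhysics.QuantumLattice.torusLift (2 * S + 1) U) * B.F (Literature.MathematicalPhysics.QuantumLattice.configShift (-Pi.single 0 (n : ℤ)) (Literature.MathematicalPhysics.QuantumLattice.torusLift (2 * S + 1) U)) ∂(Literature.MathematicalPhysics.QuantumLattice.groupHeatKernelMeasure (d := 4) (L := 2 * S + 1) w s)) - (∫ U, A.F (Literature.MathematicalPhysics.QuantumLattice.torusLift (2 * S + 1) U) ∂(Literature.MathematicalPhysics.QuantumLattice.groupHeatKernelMeasure (d := 4) (L := 2 * S + 1) w s)) * (∫ U, B.F (Literature.MathematicalPhysics.QuantumLattice.torusLift (2 * S + 1) U) ∂(Literature.MathematicalPhysics.QuantumLattice.groupHeatKernelMeasure (d := 4) (L := 2 * S + 1) w s))| ≤ C * Real.exp (-(m * n));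
      let Pseq : (G → ℝ) → ℕ → ℝ := fun v L => (((L + 1 : ℕ) : ℝ) ^ 4)⁻¹ * Real.log (((MeasureTheory.Measure.pi fun _ : Literature.MathematicalPhysics.QuantumFieldTheory.Edge 4 (L + 1) => Literature.MathematicalPhysics.QuantumFieldTheory.haarProbability G).withDensity (fun U : Literature.MathematicalPhysics.QuantumFieldTheory.GaugeConfig 4 (L + 1) G => ENNReal.ofReal (Literature.MathematicalPhysics.QuantumLattice.groupHeatKernelWeight (fun _ : ℝ => v) 0 U))) Set.univ).toReal;
      let AnP : (G → ℝ) → Prop := fun v => ∀ φ : G → ℝ, Continuous φ → (∀ g h : G, φ (h * g * h⁻¹) = φ g) → ∃ p : ℝ → ℝ, (∀ t : ℝ, Filter.Tendsto (fun L : ℕ => Pseq (fun g => v g * Real.exp (t * φ g)) L) Filter.atTop (nhds (p t))) ∧ AnalyticAt ℝ p 0;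
      let Adm : (ℝ → G → ℝ) → Prop := fun w => (∀ s ∈ Set.Icc (0 : ℝ) 1, Continuous (w s) ∧ (∀ g : G, 0 < w s g) ∧ (∀ g h : G, w s (h * g * h⁻¹) = w s g) ∧ (∀ g : G, w s g⁻¹ = w s g) ∧ (∀ (n : ℕ) (x : Fin n → G) (c : Fin n → ℂ), 0 ≤ (∑ i, ∑ j, (starRingEnd ℂ) (c i) * c j * ((w s ((x i)⁻¹ * x j) : ℝ) : ℂ)).re)) ∧ ∃ Λ : ℝ, ∀ s ∈ Set.Icc (0 : ℝ) 1, ∀ s' ∈ Set.Icc (0 : ℝ) 1, ∀ g : G, |Real.log (w s g) - Real.log (w s' g)| ≤ Λ * |s - s'|;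
      ∀ w : ℝ → G → ℝ, Adm w → (∀ s ∈ Set.Icc (0 : ℝ) 1, AnP (w s)) →
        ∃ μ : ℝ, 0 < μ ∧ ∀ s ∈ Set.Icc (0 : ℝ) 1, (∃ m : ℝ, 0 < m ∧ UCw w s m) → UCw w s μ := by
  intro G _ _ _ _ hG UCw Pseq AnP Adm w hAdm hAn
  by_cases hex : ∃ s₀ ∈ Set.Icc (0 : ℝ) 1, ∃ m₀ : ℝ, 0 < m₀ ∧ UCw w s₀ m₀
  · obtain ⟨μ, hμ, hall⟩ := pathGapModulus_iff_noGapCollapse.mp h G hG w hAdm hAn hex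
    exact ⟨μ, hμ, fun s hs _ => hall s hs⟩
  · exact ⟨1, one_pos, fun s hs hm => (hex ⟨s, hs, hm⟩).elim⟩

/-- **The reshape loses nothing, part 3**: the crux implies S3 (`stub_closedAtCommonRate`) — one approximating
parameter clustering at rate `μ` is a clustering parameter, so NoGapCollapse gives a rate at `s₀` too. [folklore] -/
theorem pathGap_closedAtRate_of_pathGapModulus
    (h : Summit.QuantumFields.YangMills.Theses.GronwallGap.PathGapModulus) :
    ∀ (G : Type) [Group G] [TopologicalSpace G] [IsTopologicalGroup G] [CompactSpace G],
      Literature.MathematicalPhysics.QuantumFieldTheory.IsCompactSimpleLieGroup G →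
      letI : MeasurableSpace G := borel G; haveI : BorelSpace G := ⟨rfl⟩;
      let UCw : (ℝ → G → ℝ) → ℝ → ℝ → Prop := fun w s m => ∀ A B : Literature.MathematicalPhysics.QuantumFieldTheory.YMSpecies G, ∃ C : ℝ, ∃ S₀ : ℕ, ∀ S : ℕ, S₀ ≤ S → ∀ n : ℕ, n ≤ S → |(∫ U, A.F (Literature.MathematicalPhysics.QuantumLattice.torusLift (2 * S + 1) U) * B.F (Literature.MathematicalPhysics.QuantumLattice.configShift (-Pi.single 0 (n : ℤ)) (Literature.MathematicalPhysics.QuantumLattice.torusLift (2 * S + 1) U)) ∂(Literature.MathematicalPhysics.QuantumLattice.groupHeatKernelMeasure (d := 4) (L := 2 * S + 1) w s)) - (∫ U, A.F (Literature.MathematicalPhysics.QuantumLattice.torusLift (2 * S + 1) U) ∂(Literature.MathematicalPhysics.QuantumLattice.groupHeatKernelMeasure (d := 4) (L := 2 * S + 1) w s)) * (∫ U, B.F (Literature.MathematicalPhysics.QuantumLattice.torusLift (2 * S + 1) U) ∂(Literature.MathematicalPhysics.QuantumLattice.groupHeatKernelMeasure (d := 4) (L := 2 * S + 1) w s))| ≤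 C * Real.exp (-(m * n));
      let Pseq : (G → ℝ) → ℕ → ℝ := fun v L => (((L + 1 : ℕ) : ℝ) ^ 4)⁻¹ * Real.log (((MeasureTheory.Measure.pi fun _ : Literature.MathematicalPhysics.QuantumFieldTheory.Edge 4 (L + 1) => Literature.MathematicalPhysics.QuantumFieldTheory.haarProbability G).withDensity (fun U : Literature.MathematicalPhysics.QuantumFieldTheory.GaugeConfig 4 (L + 1) G => ENNReal.ofReal (Literature.MathematicalPhysics.QuantumLattice.groupHeatKernelWeight (fun _ : ℝ => v) 0 U))) Set.univ).toReal;
      let AnP : (G → ℝ) → Prop := fun v => ∀ φ : G → ℝ, Continuous φ → (∀ g h : G, φ (h * g * h⁻¹) = φ g) → ∃ p : ℝ → ℝ, (∀ t : ℝ, Filter.Tendsto (fun L : ℕ => Pseq (fun g => v g * Real.exp (t * φ g)) L) Filter.atTop (nhds (p t))) ∧ AnalyticAt ℝ p 0;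
      let Adm : (ℝ → G → ℝ) → Prop := fun w => (∀ s ∈ Set.Icc (0 : ℝ) 1, Continuous (w s) ∧ (∀ g : G, 0 < w s g) ∧ (∀ g h : G, w s (h * g * h⁻¹) = w s g) ∧ (∀ g : G, w s g⁻¹ = w s g) ∧ (∀ (n : ℕ) (x : Fin n → G) (c : Fin n → ℂ), 0 ≤ (∑ i, ∑ j, (starRingEnd ℂ) (c i) * c j * ((w s ((x i)⁻¹ * x j) : ℝ) : ℂ)).re)) ∧ ∃ Λ : ℝ, ∀ s ∈ Set.Icc (0 : ℝ) 1, ∀ s' ∈ Set.Icc (0 : ℝ) 1, ∀ g : G, |Real.log (w s g) - Real.log (w s' g)| ≤ Λ * |s - s'|;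
      ∀ w : ℝ → G → ℝ, Adm w → (∀ s ∈ Set.Icc (0 : ℝ) 1, AnP (w s)) →
        ∀ s₀ ∈ Set.Icc (0 : ℝ) 1, ∀ μ : ℝ, 0 < μ → (∀ ε : ℝ, 0 < ε → ∃ s ∈ Set.Icc (0 : ℝ) 1, |s - s₀| < ε ∧ UCw w s μ) → ∃ m₀ : ℝ, 0 < m₀ ∧ UCw w s₀ m₀ := by
  intro G _ _ _ _ hG UCw Pseq AnP Adm w hAdm hAn s₀ hs₀ μ hμ happrox
  obtain ⟨s, hs, _, hU⟩ := happrox 1 one_pos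
  obtain ⟨m, hm, hall⟩ := pathGapModulus_iff_noGapCollapse.mp h G hG w hAdm hAn ⟨s, hs, μ, hμ, hU⟩
  exact ⟨m, hm, hall s₀ hs₀⟩

/-- **`PathGapModulus ↔ (S1 ∧ S2 ∧ S3)` — the trichotomy is an equivalent decomposition of the crux.** Under the
crux's verbatim preamble, for every admissible analytic-pressure path: (S1) the uniformly-clustering parameter set is
relatively open in `[0,1]`, (S2) one rate serves all its points, (S3) it is closed under approximation at a common
rate. (→) by the three converses above; (←) by `pathGapModulus_of_open_of_uniformRate_of_closedAtRate` after
splitting the conjunction. This is the registered sub-goal through which this helper file lands. [folklore] -/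
theorem pathGapModulus_iff_trichotomy :
    Summit.QuantumFields.YangMills.Theses.GronwallGap.PathGapModulus ↔
    (∀ (G : Type) [Group G] [TopologicalSpace G] [IsTopologicalGroup G] [CompactSpace G],
      Literature.MathematicalPhysics.QuantumFieldTheory.IsCompactSimpleLieGroup G →
      letI : MeasurableSpace G := borel G; haveI : BorelSpace G := ⟨rfl⟩;
      let UCw : (ℝ → G → ℝ) → ℝ → ℝ → Prop := fun w s m => ∀ A B : Literature.MathematicalPhysics.QuantumFieldTheory.YMSpecies G, ∃ C : ℝ, ∃ S₀ : ℕ, ∀ S : ℕ, S₀ ≤ S → ∀ n : ℕ, n ≤ S → |(∫ U, A.F (Literature.MathematicalPhysics.QuantumLattice.torusLift (2 * S + 1) U) * B.F (Literature.MathematicalPhysics.QuantumLattice.configShift (-Pi.single 0 (n : ℤ)) (Literature.MathematicalPhysics.QuantumLattice.torusLift (2 * S + 1) U)) ∂(Literature.MathematicalPhysics.QuantumLattice.groupHeatKernelMeasure (d := 4) (L := 2 * S + 1) w s)) - (∫ U, A.F (Literature.MathematicalPhysics.QuantumLattice.torusLift (2 * S + 1) U) ∂(Literature.MathematicalPhysics.QuantumLattice.groupHeatKernelMeasure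 (d := 4) (L := 2 * S + 1) w s)) * (∫ U, B.F (Literature.MathematicalPhysics.QuantumLattice.torusLift (2 * S + 1) U) ∂(Literature.MathematicalPhysics.QuantumLattice.groupHeatKernelMeasure (d := 4) (L := 2 * S + 1) w s))| ≤ C * Real.exp (-(m * n));
      let Pseq : (G → ℝ) → ℕ → ℝ := fun v L => (((L + 1 : ℕ) : ℝ) ^ 4)⁻¹ * Real.log (((MeasureTheory.Measure.pi fun _ : Literature.MathematicalPhysics.QuantumFieldTheory.Edge 4 (L + 1) => Literature.MathematicalPhysics.QuantumFieldTheory.haarProbability G).withDensity (fun U : Literature.MathematicalPhysics.QuantumFieldTheory.GaugeConfig 4 (L + 1) G => ENNReal.ofReal (Literature.MathematicalPhysics.QuantumLattice.groupHeatKernelWeight (fun _ : ℝ => v) 0 U))) Set.univ).toReal;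
      let AnP : (G → ℝ) → Prop := fun v => ∀ φ : G → ℝ, Continuous φ → (∀ g h : G, φ (h * g * h⁻¹) = φ g) → ∃ p : ℝ → ℝ, (∀ t : ℝ, Filter.Tendsto (fun L : ℕ => Pseq (fun g => v g * Real.exp (t * φ g)) L) Filter.atTop (nhds (p t))) ∧ AnalyticAt ℝ p 0;
      let Adm : (ℝ → G → ℝ) → Prop := fun w => (∀ s ∈ Set.Icc (0 : ℝ) 1, Continuous (w s) ∧ (∀ g : G, 0 < w s g) ∧ (∀ g h : G, w s (h * g * h⁻¹) = w s g) ∧ (∀ g : G, w s g⁻¹ = w s g) ∧ (∀ (n : ℕ) (x : Fin n → G) (c : Fin n → ℂ), 0 ≤ (∑ i, ∑ j, (starRingEnd ℂ) (c i) * c j * ((w s ((x i)⁻¹ * x j) : ℝ) : ℂ)).re)) ∧ ∃ Λ : ℝ, ∀ s ∈ Set.Icc (0 : ℝ) 1, ∀ s' ∈ Set.Icc (0 : ℝ) 1, ∀ g : G, |Real.log (w s g) - Real.log (w s' g)| ≤ Λ * |s - s'|;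
      ∀ w : ℝ → G → ℝ, Adm w → (∀ s ∈ Set.Icc (0 : ℝ) 1, AnP (w s)) →
        (∀ s₀ ∈ Set.Icc (0 : ℝ) 1, (∃ m₀ : ℝ, 0 < m₀ ∧ UCw w s₀ m₀) → ∃ ε : ℝ, 0 < ε ∧ ∀ s ∈ Set.Icc (0 : ℝ) 1, |s - s₀| < ε → ∃ m : ℝ, 0 < m ∧ UCw w s m) ∧
        (∃ μ : ℝ, 0 < μ ∧ ∀ s ∈ Set.Icc (0 : ℝ) 1, (∃ m : ℝ, 0 < m ∧ UCw w s m) → UCw w s μ) ∧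
        (∀ s₀ ∈ Set.Icc (0 : ℝ) 1, ∀ μ : ℝ, 0 < μ → (∀ ε : ℝ, 0 < ε → ∃ s ∈ Set.Icc (0 : ℝ) 1, |s - s₀| < ε ∧ UCw w s μ) → ∃ m₀ : ℝ, 0 < m₀ ∧ UCw w s₀ m₀)) := by
  constructor
  · intro h G _ _ _ _ hG UCw Pseq AnP Adm w hAdm hAn
    exact ⟨pathGap_open_of_pathGapModulus h G hG w hAdm hAn, pathGap_uniformRate_of_pathGapModulus h G hG w hAdm hAn,
      pathGap_closedAtRate_of_pathGapModulus h G hG w hAdm hAn⟩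
  · intro h
    refine pathGapModulus_of_open_of_uniformRate_of_closedAtRate ?_ ?_ ?_
    · intro G _ _ _ _ hG UCw Pseq AnP Adm w hAdm hAn
      exact (h G hG w hAdm hAn).1
    · intro G _ _ _ _ hG UCw Pseq AnP Adm w hAdm hAn
      exact (h G hG w hAdm hAn).2.1
    · intro G _ _ _ _ hG UCw Pseq AnP Adm w hAdm hAn
      exact (h G hG w hAdm hAn).2.2

end Summit.QuantumFields.YangMills.Theorems
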